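import Mathlib.GroupTheory.SpecificGroups.Dihedral
import Mathlib.GroupTheory.OrderOfElement
import Mathlib.Algebra.Group.TypeTags.Basic
import Mathlib.Data.ZMod.Basic
import HarnessLib

/-!
# Automorphisms of `A × ℤ/2` when `A` has no central involution, and characters `A → ℤ/2` — the abstract shape of the
# UNDOTTED members `Π^tp_Z = Π^tp_Ż × Gal(Ċ/C)` of the monodromy model of [EtTh] §2 (Rmk. 2.6.1)

S. Mochizuki, *The étale theta function and its Frobenioid-theoretic manifestations* [EtTh], Publ. RIMS **45**
(2009), §2 Rmk. 2.6.1 (PDF p. 40): the `Aut_K` of the dotted curves are «the direct product of the `Aut_K(−)`'s listed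
above with `Gal(Ċ^log/C^log) ≅ {±1}`» [cite: MochizukiEtTh2009, Rmk 2.6.1 p.40].  Cell abc-iut, layer L2, seat
abc-iut-w6-d084 (gen 7), «P26-NV MONODROMY TOY» STAGE 2b (typed Prop. 2.4 at the model; abc-iut-L2-lead R1352).
PROOF-ONLY group theory (no definition, no named fact; nothing of [EtTh] asserted).  In the monodromy model the UNDOTTED
members are `Π^tp_Z ≅ Π^tp_Ż × ⟨e⟩` with `⟨e⟩ = ℤ/2` the sheet of `Ÿ → Y`, and `Π^tp_Ż ∈ {ℤ, ℤ/l × ℤ, D_∞, ℤ/l × D_∞}`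
has no central involution; so:
* `mulEquiv_prodTwo_census`: for a group `A` without central involutions, every automorphism of `A × ℤ/2` is
  `(a, ε) ↦ (α a, χ(a) ε)` with `α ∈ Aut(A)` and `χ : A → ℤ/2` a character (and `e ↦ e`);
* `monoidHom_zmod_two_eq_one_of_odd`: a character `ℤ/l → ℤ/2` is trivial for `l` odd;
* `monoidHom_dihedralZero_two`, `monoidHom_int_two`: characters of `D_∞` and of `ℤ` with values in `ℤ/2` are determined
  by their values on `r`, `s` (resp. on `1`).
(toy bookkeeping for the shapes of [EtTh] Rmk. 2.6.1; classical group theory, no claim about print)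
-/

namespace Literature.AnabelianGeometry.EtaleTheta.ThetaCovers.MonodromyModel

open Multiplicative DihedralGroup

/-! ## 1. `A × ℤ/2` -/

/-- In `ℤ/2` (multiplicative) every element squares to `1`. (toy bookkeeping for [EtTh] Rmk. 2.6.1 «`Gal(Ċ/C) ≅ {±1}`»;
no claim about print) [cite: MochizukiEtTh2009, Rmk 2.6.1 p.40] -/
theorem mul_self_zmod_two (y : Multiplicative (ZMod 2)) : y * y = 1 := by
  revert y; decide

/-- In `ℤ/2` (multiplicative) an element `≠ 1` is `ofAdd 1`. (toy bookkeeping for [EtTh] Rmk. 2.6.1; no claim about print)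
[cite: MochizukiEtTh2009, Rmk 2.6.1 p.40] -/
theorem eq_ofAdd_one_of_ne_one {y : Multiplicative (ZMod 2)} (h : y ≠ 1) : y = ofAdd 1 := by
  revert y; decide

/-- **Automorphism census of `A × ℤ/2` for `A` without central involutions**: `φ(a, ε) = (α a, χ(a) · ε)` with
`α ∈ Aut(A)`, `χ : A → ℤ/2` a homomorphism; in particular `φ(e) = e` for the generator `e` of `ℤ/2`.
(toy bookkeeping for [EtTh] Rmk. 2.6.1 «direct product with `Gal(Ċ/C)`»; classical, no claim about print)
[cite: MochizukiEtTh2009, Rmk 2.6.1 p.40] -/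
theorem mulEquiv_prodTwo_census {A : Type*} [Group A]
    (hA : ∀ z : A, (∀ a : A, a * z = z * a) → z * z = 1 → z = 1)
    (φ : (A × Multiplicative (ZMod 2)) ≃* (A × Multiplicative (ZMod 2))) :
    ∃ (α : A ≃* A) (χ : A →* Multiplicative (ZMod 2)), ∀ a ε, φ (a, ε) = (α a, χ a * ε) := by
  -- `φ(1, e) = (1, e)`: it is a central involution
  have he : ∀ ε : Multiplicative (ZMod 2), φ (1, ε) = (1, ε) := by
    intro ε
    by_cases hε : ε = 1
    · rw [hε, Prod.mk_one_one, map_one]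
    have hcen : ∀ x, x * φ (1, ε) = φ (1, ε) * x := fun x => by
      have h := congrArg φ (show φ.symm x * (1, ε) = (1, ε) * φ.symm x from
        Prod.ext (by simp) (mul_comm _ _))
      simpa [map_mul] using h
    have hsq : φ (1, ε) * φ (1, ε) = 1 := by
      rw [← map_mul, Prod.mk_mul_mk, one_mul, mul_self_zmod_two, Prod.mk_one_one, map_one]
    have h1 : (φ (1, ε)).1 = 1 := hA _ (fun a => by
      have := congrArg Prod.fst (hcen (a, 1))
      simpa using this) (by have := congrArg Prod.fst hsq; simpa using this)
    have h2 : (φ (1, ε)).2 ≠ 1 := fun h => by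
      have : φ (1, ε) = 1 := Prod.ext h1 h
      rw [map_eq_one_iff _ φ.injective, Prod.mk_eq_one] at this
      exact hε this.2
    exact Prod.ext h1 (by rw [eq_ofAdd_one_of_ne_one h2, eq_ofAdd_one_of_ne_one hε])
  -- `α := pr₁ ∘ φ ∘ ι₁`, `χ := pr₂ ∘ φ ∘ ι₁`
  let α₀ : A →* A := (MonoidHom.fst A (Multiplicative (ZMod 2))).comp (φ.toMonoidHom.comp (MonoidHom.inl A _))
  let χ : A →* Multiplicative (ZMod 2) :=
    (MonoidHom.snd A (Multiplicative (ZMod 2))).comp (φ.toMonoidHom.comp (MonoidHom.inl A _))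
  have hφ : ∀ a ε, φ (a, ε) = (α₀ a, χ a * ε) := fun a ε => by
    rw [show ((a, ε) : A × Multiplicative (ZMod 2)) = (a, 1) * (1, ε) by simp, map_mul, he]
    exact Prod.ext (by simp [α₀]) (by simp [χ])
  -- `α₀` is bijective
  have hinj : Function.Injective α₀ := fun a b hab => by
    have h1 : φ (a * b⁻¹, 1) = (1, χ (a * b⁻¹)) := by
      rw [hφ, mul_one, map_mul, map_inv, hab, mul_inv_cancel]
    by_cases hc : χ (a * b⁻¹) = 1
    · rw [hc, Prod.mk_one_one, map_eq_one_iff _ φ.injective, Prod.mk_eq_one] at h1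
      exact mul_inv_eq_one.mp h1.1
    · exfalso
      rw [← he, φ.apply_eq_iff_eq, Prod.mk.injEq] at h1
      exact hc h1.2.symm
  have hsurj : Function.Surjective α₀ := fun a' => by
    obtain ⟨⟨a, ε⟩, h⟩ := φ.surjective (a', 1)
    rw [hφ] at h
    exact ⟨a, (Prod.ext_iff.mp h).1⟩
  exact ⟨MulEquiv.ofBijective α₀ ⟨hinj, hsurj⟩, χ, hφ⟩

/-! ## 2. Characters with values in `ℤ/2` -/

/-- A character `ℤ/l → ℤ/2` is trivial when `l` is odd. (toy bookkeeping for [EtTh] Rmk. 2.6.1; classical, no claim about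
print) [cite: MochizukiEtTh2009, Rmk 2.6.1 p.40] -/
theorem monoidHom_zmod_two_eq_one_of_odd {l : ℕ} (hl : Odd l) (χ : Multiplicative (ZMod l) →* Multiplicative (ZMod 2))
    (c : Multiplicative (ZMod l)) : χ c = 1 := by
  have h1 : c ^ l = 1 := by
    apply toAdd.injective
    rw [toAdd_pow, toAdd_one, nsmul_eq_mul, ZMod.natCast_self, zero_mul]
  have h2 : χ c ^ l = 1 := by rw [← map_pow, h1, map_one]
  obtain ⟨k, rfl⟩ := hl
  rw [pow_succ, pow_mul, show χ c ^ 2 = 1 from by rw [sq, mul_self_zmod_two], one_pow, one_mul] at h2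
  exact h2

/-- A character of `ℤ` with values in `ℤ/2` is `n ↦ χ(1)^n`. (toy bookkeeping for [EtTh] Rmk. 2.6.1; classical, no claim
about print) [cite: MochizukiEtTh2009, Rmk 2.6.1 p.40] -/
theorem monoidHom_int_two (χ : Multiplicative ℤ →* Multiplicative (ZMod 2)) (n : Multiplicative ℤ) :
    χ n = χ (ofAdd 1) ^ toAdd n := by
  rw [← map_zpow]
  congr 1
  apply toAdd.injective
  rw [toAdd_zpow, toAdd_ofAdd, smul_eq_mul, mul_one]

/-- A character of `D_∞` with values in `ℤ/2`: `χ(r^i) = χ(r)^i`, `χ(s r^i) = χ(s) χ(r)^i`. (toy bookkeeping for [EtTh]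
Rmk. 2.6.1; classical, no claim about print) [cite: MochizukiEtTh2009, Rmk 2.6.1 p.40] -/
theorem monoidHom_dihedralZero_two (χ : DihedralGroup 0 →* Multiplicative (ZMod 2)) (i : ZMod 0) :
    χ (r i) = χ (r 1) ^ (show ℤ from i) ∧ χ (sr i) = χ (sr 0) * χ (r 1) ^ (show ℤ from i) := by
  have h1 : χ (r i) = χ (r 1) ^ (show ℤ from i) := by
    rw [← map_zpow, r_one_zpow]; rfl
  exact ⟨h1, by rw [show sr i = sr 0 * r i by rw [sr_mul_r, zero_add], map_mul, h1]⟩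

/-! ## 3. No central involutions in `ℤ`, `ℤ/l × ℤ` -/

/-- `ℤ` has no involution. (toy bookkeeping for [EtTh] Rmk. 2.6.1; classical) [cite: MochizukiEtTh2009, Rmk 2.6.1 p.40] -/
theorem int_no_involution (z : Multiplicative ℤ) (_hc : ∀ a, a * z = z * a) (h : z * z = 1) : z = 1 := by
  apply toAdd.injective
  have h2 := congrArg toAdd h
  rw [toAdd_mul, toAdd_one] at h2
  rw [toAdd_one]
  omega

/-- `ℤ/l × ℤ` (`l` odd) has no involution. (toy bookkeeping for [EtTh] Rmk. 2.6.1; classical)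
[cite: MochizukiEtTh2009, Rmk 2.6.1 p.40] -/
theorem zmodProdInt_no_involution {l : ℕ} (hl : Odd l) (z : Multiplicative (ZMod l × ℤ)) (_hc : ∀ a, a * z = z * a)
    (h : z * z = 1) : z = 1 := by
  apply toAdd.injective
  have h2 := congrArg toAdd h
  rw [toAdd_mul, toAdd_one, Prod.ext_iff, Prod.fst_add, Prod.snd_add, Prod.fst_zero, Prod.snd_zero] at h2
  rw [toAdd_one, Prod.ext_iff, Prod.fst_zero, Prod.snd_zero]
  refine ⟨?_, by omega⟩
  have hu : IsUnit (2 : ZMod l) := by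
    have := (ZMod.unitOfCoprime 2 (Nat.coprime_two_left.mpr hl)).isUnit
    simpa using this
  exact (hu.mul_right_eq_zero).mp (by rw [two_mul]; exact h2.1)

end Literature.AnabelianGeometry.EtaleTheta.ThetaCovers.MonodromyModel
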